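import Summits.QuantumFields.YangMills.Theorems.BalabanUVNodesN10AtRecord13Witness
import Literature.MathematicalPhysics.QuantumFieldTheory.Balaban1983to89.Node00.Record13LiveSelectorFamily

/-!
# BalabanUVNodes ∕ N10 ON NODE 00's STAGE-13 WITNESS FAMILIES `θ₁₃(n, ε₂₉) = Node00.theta13LiveOfNumerics F N n ε₂₉ …` (EVERY numeric letter open) and
# `θ₁₃(ε₀, ε₂₉) = Node00.theta13LiveOfFamily₂ F N ε₀ ε₂₉ …` (node00-def-K0a FILE 9 `Node00/Record13LiveSelectorFamily`), so that N10's conjunct of K1‴'s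
# `NodesAtSomeRecord13` is witnessed AT THE SAME MEMBER `θL F n ε₂₉` the K0‴ rungs of record read (plan g66, skeleton v5b-NUM13) — Track A, DAG node N10 [B13];
# strategy s2; seat `pub-ymgap-dag-n10-d` g6; the family re-instantiation of `…N10AtRecord13Witness` (p492844), as dag-n08-c's `…N08AtRecord13Family` is for N08

HONEST FRAMING.  Count-neutral kernel bookkeeping over LANDED modules: K0a's `Node00/Record13LiveSelectorFamily` (p490977: the all-numerics family
`theta13LiveOfNumerics F N n ε₂₉ ζ Rz Zt := (theta13OfNumerics …).liveRepin₁₃` over the dictionary OF THE FAMILY — block size `F.L` —, with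
`admissible_theta13LiveOfNumerics (hn : n.Pos) (hε' : 0 < ε₂₉)`, `eight_le_L_theta13LiveOfNumerics`, `ztUnity_theta13LiveOfNumerics`,
`slotsNondegenerate₁₃_theta13LiveOfNumerics (h : Provisos₁₃)`, `provisos₁₃_theta13LiveOfNumerics_of_bg (hbg)`; the two-letter family `theta13LiveOfFamily₂` = the member
`n := stage12NumericsOfFamily ε₀` by `rfl`, `κ = 2·10⁴` and `γ = ½` there by `rfl`; the witness of record `theta13LiveOfRecord F N` = the member `(1, ⅛)` by `rfl`) and
this seat's `…N10AtRecord13B13` (p491722: the K1‴-facing ∃-faces over the [B13] pin `Stage13Params.pinB13` at Stage 13).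
§1 AT THE ALL-NUMERICS MEMBER `θ₁₃(n, ε₂₉)` (K0b's residuals of record `zeta316OfRecord ∕ RzOfRecord ∕ ZtOfRecord`): the window is `n.γ` and the §2 rate `κ = n.s2.lf.κ`
is OPEN — so N10's re-pinned rate row `2·10⁴ ≤ κ` is NOT a theorem of the member (it is a HYPOTHESIS on `n` for the rate-discharged junctions of
`…N10AtRecord12B13FamilyWitness` §3 ∕ `…RateDischarged`), while the level-T binders ARE: `8 ≤ ℓ₆ + 1` (K0a's `eight_le_L_theta13LiveOfNumerics`, the cure of
LOCATED-N10-ELL) and `12 ≤ (ℓ₆ + 1)·(m + 1)` for every torus index (`twelve_le_L_mul_theta13LiveOfNumerics`).  Then N10's CONJUNCT OF `stub_nodes13`'s `NodesAtSomeRecord13`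
AT THE MEMBER: from `n.Pos`, `0 < ε₂₉`, `Provisos₁₃` at the member (K0‴'s residual hypothesis; FROM ROW P11 ALONE by K0a's reduction) and THE LEAF at a per-run [B13]
layer (resp. the family leaf of record at selected box members), the world bound at the C-binding of the [B13]-pinned Stage-13 view of the member is a ₁₃C record OF
THE MEMBER's DATUM, window `n.γ`, block size `F.L`, guard and admissibility K0a's theorems, and `Dag.B13_main` at every run; packaged as the ∃-shape of `NodesAtSomeRecord13`
restricted to N10's conjunct, at general `N` and at `N = 2`.  §2 THE SAME AT THE TWO-LETTER MEMBER `θ₁₃(ε₀, ε₂₉)` (window `½`; there the rate row IS K0a's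
`kp_n10_theta13LiveOfFamily₂`).  §3 HONESTY: at every member the ∃-currency is junk-dischargeable through def-B13's zero tower (`…N10AtRecord13B13` §3) — so §1–§2
carry content only when `lam13` is the term tower OF RECORD with the leaf supplied from located inputs that are theorems about it.  What the file does NOT supply: the
leaf (NODE A's content + the located Lemma 1–2 inputs), the other twelve nodes at the same world, row P11.  Nothing of Bałaban's is asserted; N10 is NOT discharged;
K0‴ ∕ K1‴ NOT asserted; no node count moves; one finite four-torus programme at fixed ε per run; nothing continuum ∕ ℝ⁴ ∕ OS ∕ mass-gap ∕ Clay.  0 `sorry`, 0 `def`,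
standard axioms.  Filed `--supports` K1‴ «StabilityBAtRecordR13e» (stmt-QuantumFields-19910) of route «BalabanUVNodes».

WHAT THIS FILE PROVES.  §1 `twelve_le_L_mul_theta13LiveOfNumerics`, `exists_record₁₃C_guarded_b13_main_at_theta13LiveOfNumerics_of_leafOfRecord ∕ _of_famLeafOfRecord`,
`exists_guarded_record₁₃C_b13_main_of_theta13Numerics_provisos_at ∕ _two`, `exists_guarded_record₁₃C_b13_main_of_bg_numerics_at ∕ _two`;
§2 `twelve_le_L_mul_theta13LiveOfFamily₂`, `exists_record₁₃C_guarded_b13_main_at_theta13LiveOfFamily₂_of_leafOfRecord ∕ _of_famLeafOfRecord`,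
`exists_guarded_record₁₃C_b13_main_of_theta13Family₂_provisos_two`, `exists_guarded_record₁₃C_b13_main_of_bg_family₂_two`;
§3 `exists_guarded_record₁₃C_b13_main_of_theta13Numerics_provisos_of_zeroTower`, `exists_guarded_record₁₃C_b13_main_of_bg_numerics_two_of_zeroTower`.
-/

namespace Summit.QuantumFields.YangMills.BalabanUVNodes.N10AtRecord13WitnessFamily

open Literature.MathematicalPhysics.QuantumFieldTheory.Balaban1983to89
open Literature.MathematicalPhysics.QuantumFieldTheory.Balaban1983to89.T4Continuum
open Literature.MathematicalPhysics.QuantumFieldTheory.Balaban1983to89.DagBinding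
open Literature.MathematicalPhysics.QuantumFieldTheory.Balaban1983to89.Node00
open Summit.QuantumFields.YangMills.BalabanUVNodes.N10AtRecord13B13
  (exists_record₁₃C_pinB13World_b13_main_of_leafOfRecord exists_record₁₃C_pinB13World_b13_main_of_famLeafOfRecord exists_record₁₃C_world_b13_main_of_zeroTower)
open scoped Matrix.Norms.L2Operator

/-! ## §1. On the all-numerics Stage-13 witness family `θ₁₃(n, ε₂₉) = theta13LiveOfNumerics F N n ε₂₉ (zeta316OfRecord F N n.ν n.τ9.M n.A₁) (RzOfRecord F N) (ZtOfRecord F N)` -/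

section Numerics

variable (F : T4Family) (N : ℕ) [NeZero N] (n : Stage12Numerics) (ε₂₉ : ℝ)

/-- **The torus-size binder `hN12` HOLDS at every member of the all-numerics family, for EVERY torus index `m`**: `12 ≤ (θ₁₃(n, ε₂₉).ℓ₆ + 1)·(m + 1)` (the dictionary
OF THE FAMILY: `ℓ₆ + 1 = F.L ≥ 13`, K0a's `theta13OfNumerics_ℓ₆_succ` through the live re-pin).  The level-T binder `hL8 : 8 ≤ ℓ₆ + 1` is K0a's
`eight_le_L_theta13LiveOfNumerics`. [cite: Balaban1987RG1, (3.54) p.285 and p.251 («L is an odd, positive integer > 11»); Balaban1988RG2Cluster, (2.36) p.19 (bookkeeping numeral)] -/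
theorem twelve_le_L_mul_theta13LiveOfNumerics (m : ℕ) :
    12 ≤ ((theta13LiveOfNumerics F N n ε₂₉ (zeta316OfRecord F N n.ν n.τ9.M n.A₁) (RzOfRecord F N) (ZtOfRecord F N)).ℓ₆ + 1) * (m + 1) := by
  have hL : (theta13LiveOfNumerics F N n ε₂₉ (zeta316OfRecord F N n.ν n.τ9.M n.A₁) (RzOfRecord F N) (ZtOfRecord F N)).ℓ₆ + 1 = F.L :=
    theta13OfNumerics_ℓ₆_succ F N n ε₂₉ (zeta316OfRecord F N n.ν n.τ9.M n.A₁) (RzOfRecord F N) (ZtOfRecord F N)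
  rw [hL]
  have h11 := F.hL11
  calc 12 ≤ F.L := by omega
    _ = F.L * 1 := (Nat.mul_one _).symm
    _ ≤ F.L * (m + 1) := Nat.mul_le_mul_left _ (Nat.succ_le_succ (Nat.zero_le m))

variable {n ε₂₉}

/-- **N10's CONJUNCT OF `NodesAtSomeRecord13` AT THE MEMBER `θ₁₃(n, ε₂₉)`, FROM THE LEAF.**  Given `n.Pos`, `0 < ε₂₉` (K0a's `admissible_theta13LiveOfNumerics`),
`Provisos₁₃` at the member (K0‴'s residual hypothesis) and a per-run [B13] layer `lam13` carrying the leaf at the group of record at every run, there is a world — the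
C-binding of the [B13]-pinned Stage-13 view of the member, window `n.γ`, block size `F.L` — that is a ₁₃C record OF THE MEMBER's DATUM with the rev-16 guard
`ZtUnity ∧ SlotsNondegenerate₁₃` and admissibility holding AT THE MEMBER (K0a's theorems) and `Dag.B13_main` at every run (`…N10AtRecord13B13` §2 at the member).
Count-neutral; nothing of Bałaban's asserted. [cite: Balaban1988RG2Cluster, Lemmas 1–3 pp.9, 11, 20; Balaban1989LargeFieldII, Thm 1 + (0.1) pp.355–356; Balaban1988Convergent, (3.16)–(3.22) pp.268–269 (the guard); Balaban1987RG1, (0.21) p.256, (2.9) p.266 (bookkeeping)] -/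
theorem exists_record₁₃C_guarded_b13_main_at_theta13LiveOfNumerics_of_leafOfRecord (hn : n.Pos) (hε' : 0 < ε₂₉)
    (hP : (theta13LiveOfNumerics F N n ε₂₉ (zeta316OfRecord F N n.ν n.τ9.M n.A₁) (RzOfRecord F N) (ZtOfRecord F N)).Provisos₁₃ F N)
    (lam13 : B12.RunParams → ResidB13 (theta13LiveOfNumerics F N n ε₂₉ (zeta316OfRecord F N n.ν n.τ9.M n.A₁) (RzOfRecord F N) (ZtOfRecord F N)).toStage3Params)
    (hleaf : ∀ P, B13LeafOfRecord (theta13LiveOfNumerics F N n ε₂₉ (zeta316OfRecord F N n.ν n.τ9.M n.A₁) (RzOfRecord F N) (ZtOfRecord F N)).toStage3Params (lam13 P)) :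
    ∃ w : WorldP,
      ((theta13LiveOfNumerics F N n ε₂₉ (zeta316OfRecord F N n.ν n.τ9.M n.A₁) (RzOfRecord F N) (ZtOfRecord F N)).ZtUnity F N ∧
          (theta13LiveOfNumerics F N n ε₂₉ (zeta316OfRecord F N n.ν n.τ9.M n.A₁) (RzOfRecord F N) (ZtOfRecord F N)).SlotsNondegenerate₁₃ F N) ∧
        (theta13LiveOfNumerics F N n ε₂₉ (zeta316OfRecord F N n.ν n.τ9.M n.A₁) (RzOfRecord F N) (ZtOfRecord F N)).Admissible F N ∧
        IsRecordOfRecord₁₃C F N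
          (datumOfRecord₁₃ F N (theta13LiveOfNumerics F N n ε₂₉ (zeta316OfRecord F N n.ν n.τ9.M n.A₁) (RzOfRecord F N) (ZtOfRecord F N)) hP) w ∧
        w.γ = n.γ ∧ w.L = (F.L : ℝ) ∧
        (∀ P, w.up P = upOfRecord₅C F N
          (((theta13LiveOfNumerics F N n ε₂₉ (zeta316OfRecord F N n.ν n.τ9.M n.A₁) (RzOfRecord F N) (ZtOfRecord F N)).pinB13 F N lam13).toStage5₁₃ F N) P) ∧
        ∀ P : B12.RunParams, Dag.B13_main (leavesP w P) := by
  have hθ := admissible_theta13LiveOfNumerics F N (zeta316OfRecord F N n.ν n.τ9.M n.A₁) (RzOfRecord F N) (ZtOfRecord F N) hn hε'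
  obtain ⟨w, hR, hγ, hL, hup, hN⟩ := exists_record₁₃C_pinB13World_b13_main_of_leafOfRecord F N _ hP hθ lam13 (γw := n.γ)
    ⟨hθ.toStage9.gamma_pos, le_rfl⟩ hleaf
  exact ⟨w, ⟨ztUnity_theta13LiveOfNumerics F N n ε₂₉, slotsNondegenerate₁₃_theta13LiveOfNumerics F N n ε₂₉ _ _ _ hP⟩, hθ, hR, hγ, hL, hup, hN⟩

/-- **THE SAME FROM THE FAMILY LEAF OF RECORD** at selected box members `(κ P, ν P)` with the letters of record (the Stage-12∕13 family currency read at the member's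
`toStage12Params`; def-B13 g3's member bridge `b13LeafOfRecord_member₁₂`). [cite: Balaban1988RG2Cluster, Lemmas 1–3 pp.9, 11, 20; Balaban1987RG1, Thm 3 p.264; Balaban1989LargeFieldII, Thm 1 + (0.1) pp.355–356] -/
theorem exists_record₁₃C_guarded_b13_main_at_theta13LiveOfNumerics_of_famLeafOfRecord (hn : n.Pos) (hε' : 0 < ε₂₉)
    (hP : (theta13LiveOfNumerics F N n ε₂₉ (zeta316OfRecord F N n.ν n.τ9.M n.A₁) (RzOfRecord F N) (ZtOfRecord F N)).Provisos₁₃ F N) (c : B13.Consts)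
    (lamF : ResidB13Fam₁₂ F N (theta13LiveOfNumerics F N n ε₂₉ (zeta316OfRecord F N n.ν n.τ9.M n.A₁) (RzOfRecord F N) (ZtOfRecord F N)).toStage12Params)
    (hleaf : ∀ P, B13FamLeafOfRecord₁₂ F N
      (theta13LiveOfNumerics F N n ε₂₉ (zeta316OfRecord F N n.ν n.τ9.M n.A₁) (RzOfRecord F N) (ZtOfRecord F N)).toStage12Params c lamF P)
    (κ : B12.RunParams → ℕ) (ν : (P : B12.RunParams) → Fin (κ P + 1) → ℝ) (hν : ∀ P, ν P ∈ FlowStep.Box n.γ (κ P))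
    (hc : ∀ P, (lamF P (κ P) (ν P)).c =
      c13OfRecord₁₂ F N (theta13LiveOfNumerics F N n ε₂₉ (zeta316OfRecord F N n.ν n.τ9.M n.A₁) (RzOfRecord F N) (ZtOfRecord F N)).toStage12Params c) :
    ∃ w : WorldP,
      ((theta13LiveOfNumerics F N n ε₂₉ (zeta316OfRecord F N n.ν n.τ9.M n.A₁) (RzOfRecord F N) (ZtOfRecord F N)).ZtUnity F N ∧
          (theta13LiveOfNumerics F N n ε₂₉ (zeta316OfRecord F N n.ν n.τ9.M n.A₁) (RzOfRecord F N) (ZtOfRecord F N)).SlotsNondegenerate₁₃ F N) ∧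
        (theta13LiveOfNumerics F N n ε₂₉ (zeta316OfRecord F N n.ν n.τ9.M n.A₁) (RzOfRecord F N) (ZtOfRecord F N)).Admissible F N ∧
        IsRecordOfRecord₁₃C F N
          (datumOfRecord₁₃ F N (theta13LiveOfNumerics F N n ε₂₉ (zeta316OfRecord F N n.ν n.τ9.M n.A₁) (RzOfRecord F N) (ZtOfRecord F N)) hP) w ∧
        w.γ = n.γ ∧ w.L = (F.L : ℝ) ∧
        (∀ P, w.up P = upOfRecord₅C F N
          (((theta13LiveOfNumerics F N n ε₂₉ (zeta316OfRecord F N n.ν n.τ9.M n.A₁) (RzOfRecord F N) (ZtOfRecord F N)).pinB13 F N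
            fun P => lamF P (κ P) (ν P)).toStage5₁₃ F N) P) ∧
        ∀ P : B12.RunParams, Dag.B13_main (leavesP w P) :=
  exists_record₁₃C_guarded_b13_main_at_theta13LiveOfNumerics_of_leafOfRecord F N hn hε' hP (fun P => lamF P (κ P) (ν P))
    fun P => b13LeafOfRecord_member₁₂ (hleaf P) (hν P) (hc P)

/-- **N10's CONJUNCT OF THE STAGE-13 NODES-∃, WITNESSED AT THE MEMBER `θ₁₃(n, ε₂₉)`, general `N`** (director-ym LINE №127 «general-N where free») — from K0‴'s
open rows at the member (`hP : Provisos₁₃`, HYPOTHESIS), the signs `n.Pos`, `0 < ε₂₉`, and THE LEAF at a per-run [B13] layer: the ∃-shape of `NodesAtSomeRecord13`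
with `Nodes` replaced by its N10 conjunct, witnesses `(θ₁₃(n, ε₂₉), hP, w)`.  NOT the stub, NOT a discharge; the leaf is a hypothesis. [cite: Balaban1988RG2Cluster, Lemmas 1–3 pp.9, 11, 20; Balaban1988Convergent, Thm 1 p.262, (3.16)–(3.22) pp.268–269; Balaban1989LargeFieldI, (0.3)–(0.4) p.176 (bookkeeping)] -/
theorem exists_guarded_record₁₃C_b13_main_of_theta13Numerics_provisos_at (hn : n.Pos) (hε' : 0 < ε₂₉)
    (hP : (theta13LiveOfNumerics F N n ε₂₉ (zeta316OfRecord F N n.ν n.τ9.M n.A₁) (RzOfRecord F N) (ZtOfRecord F N)).Provisos₁₃ F N)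
    (lam13 : B12.RunParams → ResidB13 (theta13LiveOfNumerics F N n ε₂₉ (zeta316OfRecord F N n.ν n.τ9.M n.A₁) (RzOfRecord F N) (ZtOfRecord F N)).toStage3Params)
    (hleaf : ∀ P, B13LeafOfRecord (theta13LiveOfNumerics F N n ε₂₉ (zeta316OfRecord F N n.ν n.τ9.M n.A₁) (RzOfRecord F N) (ZtOfRecord F N)).toStage3Params (lam13 P)) :
    ∃ (θ : Stage13Params F N) (h : θ.Provisos₁₃ F N) (w : WorldP), (θ.ZtUnity F N ∧ θ.SlotsNondegenerate₁₃ F N) ∧ θ.Admissible F N ∧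
      IsRecordOfRecord₁₃C F N (datumOfRecord₁₃ F N θ h) w ∧ ∀ P : B12.RunParams, Dag.B13_main (leavesP w P) := by
  obtain ⟨w, hZ, hθ, hR, -, -, -, hN⟩ := exists_record₁₃C_guarded_b13_main_at_theta13LiveOfNumerics_of_leafOfRecord F N hn hε' hP lam13 hleaf
  exact ⟨_, hP, w, hZ, hθ, hR, hN⟩

/-- **… at `N = 2`** (the group of record `SU(2)`; K1‴'s `NodesAtSomeRecord13 F` ∃-shape with `Nodes` replaced by its N10 conjunct, witnessed at the member
`θL F n ε₂₉`). [cite: Balaban1988RG2Cluster, Lemmas 1–3 pp.9, 11, 20; Balaban1988Convergent, Thm 1 p.262 (bookkeeping)] -/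
theorem exists_guarded_record₁₃C_b13_main_of_theta13Numerics_provisos_two (F : T4Family) {n : Stage12Numerics} {ε₂₉ : ℝ} (hn : n.Pos) (hε' : 0 < ε₂₉)
    (hP : (theta13LiveOfNumerics F 2 n ε₂₉ (zeta316OfRecord F 2 n.ν n.τ9.M n.A₁) (RzOfRecord F 2) (ZtOfRecord F 2)).Provisos₁₃ F 2)
    (lam13 : B12.RunParams → ResidB13 (theta13LiveOfNumerics F 2 n ε₂₉ (zeta316OfRecord F 2 n.ν n.τ9.M n.A₁) (RzOfRecord F 2) (ZtOfRecord F 2)).toStage3Params)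
    (hleaf : ∀ P, B13LeafOfRecord (theta13LiveOfNumerics F 2 n ε₂₉ (zeta316OfRecord F 2 n.ν n.τ9.M n.A₁) (RzOfRecord F 2) (ZtOfRecord F 2)).toStage3Params (lam13 P)) :
    ∃ (θ : Stage13Params F 2) (h : θ.Provisos₁₃ F 2) (w : WorldP), (θ.ZtUnity F 2 ∧ θ.SlotsNondegenerate₁₃ F 2) ∧ θ.Admissible F 2 ∧
      IsRecordOfRecord₁₃C F 2 (datumOfRecord₁₃ F 2 θ h) w ∧ ∀ P : B12.RunParams, Dag.B13_main (leavesP w P) :=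
  exists_guarded_record₁₃C_b13_main_of_theta13Numerics_provisos_at F 2 hn hε' hP lam13 hleaf

/-- **★ N10's CONJUNCT OF THE STAGE-13 NODES-∃ AT THE MEMBER `θ₁₃(n, ε₂₉)`, general `N`, FROM EXACTLY: the signs `n.Pos`, `0 < ε₂₉`; ROW P11 `bg` AT THE MEMBER
(verbatim the hypothesis text of K0a's socket `provisos₁₃_theta13LiveOfNumerics_of_bg`, on the ranged token `BgProvisoΛ`; K0a supplies every other proviso row by
theorem); AND THE LEAF at a per-run [B13] layer.**  A REDUCTION — NOT a discharge; nothing of Bałaban's asserted. [cite: Balaban1988RG2Cluster, Lemmas 1–3 pp.9, 11, 20; Balaban1988Convergent, (2.7) p.255, (2.28) p.259, (3.16)–(3.22) pp.268–269; Balaban1989LargeFieldI, (0.3)–(0.4) p.176 (bookkeeping)] -/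
theorem exists_guarded_record₁₃C_b13_main_of_bg_numerics_at (hn : n.Pos) (hε' : 0 < ε₂₉)
    (hbg : ∀ (p : B12.RunParams) (m : ℕ), m ≤ p.K →
      Step.InInterval (theta13OfNumerics F N n ε₂₉ (zeta316OfRecord F N n.ν n.τ9.M n.A₁) (RzOfRecord F N) (ZtOfRecord F N)).γ m
        (gOfRecord₁₃ F N (theta13OfNumerics F N n ε₂₉ (zeta316OfRecord F N n.ν n.τ9.M n.A₁) (RzOfRecord F N) (ZtOfRecord F N)) p) →
      BgProvisoΛ F N p.K
        (settingOfRecord₁₃ F N (theta13LiveOfNumerics F N n ε₂₉ (zeta316OfRecord F N n.ν n.τ9.M n.A₁) (RzOfRecord F N) (ZtOfRecord F N)) p)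
        (RzOfRecord F N p.K) n.τ9.M m
        (suppOfRecord₁₃ F N (theta13LiveOfNumerics F N n ε₂₉ (zeta316OfRecord F N n.ν n.τ9.M n.A₁) (RzOfRecord F N) (ZtOfRecord F N)) p m)
        (UbgOfRecord₁₃ F N (theta13LiveOfNumerics F N n ε₂₉ (zeta316OfRecord F N n.ν n.τ9.M n.A₁) (RzOfRecord F N) (ZtOfRecord F N)) p m))
    (lam13 : B12.RunParams → ResidB13 (theta13LiveOfNumerics F N n ε₂₉ (zeta316OfRecord F N n.ν n.τ9.M n.A₁) (RzOfRecord F N) (ZtOfRecord F N)).toStage3Params)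
    (hleaf : ∀ P, B13LeafOfRecord (theta13LiveOfNumerics F N n ε₂₉ (zeta316OfRecord F N n.ν n.τ9.M n.A₁) (RzOfRecord F N) (ZtOfRecord F N)).toStage3Params (lam13 P)) :
    ∃ (θ : Stage13Params F N) (h : θ.Provisos₁₃ F N) (w : WorldP), (θ.ZtUnity F N ∧ θ.SlotsNondegenerate₁₃ F N) ∧ θ.Admissible F N ∧
      IsRecordOfRecord₁₃C F N (datumOfRecord₁₃ F N θ h) w ∧ ∀ P : B12.RunParams, Dag.B13_main (leavesP w P) :=
  exists_guarded_record₁₃C_b13_main_of_theta13Numerics_provisos_at F N hn hε' (provisos₁₃_theta13LiveOfNumerics_of_bg F N n ε₂₉ hbg) lam13 hleaf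

/-- **★★ … at `N = 2`: N10's conjunct of K1‴'s `NodesAtSomeRecord13 F`, WITNESSED AT THE MEMBER `θL F n ε₂₉` THE K0‴ RUNGS CHOOSE, from `n.Pos`, `0 < ε₂₉`, row P11
at the member and the leaf.**  A REDUCTION — NOT a discharge. [cite: Balaban1988RG2Cluster, Lemmas 1–3 pp.9, 11, 20; Balaban1988Convergent, Thm 1 p.262, (2.28) p.259, (3.16)–(3.22) pp.268–269; Balaban1989LargeFieldI, (0.3)–(0.4) p.176 (bookkeeping)] -/
theorem exists_guarded_record₁₃C_b13_main_of_bg_numerics_two (F : T4Family) {n : Stage12Numerics} {ε₂₉ : ℝ} (hn : n.Pos) (hε' : 0 < ε₂₉)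
    (hbg : ∀ (p : B12.RunParams) (m : ℕ), m ≤ p.K →
      Step.InInterval (theta13OfNumerics F 2 n ε₂₉ (zeta316OfRecord F 2 n.ν n.τ9.M n.A₁) (RzOfRecord F 2) (ZtOfRecord F 2)).γ m
        (gOfRecord₁₃ F 2 (theta13OfNumerics F 2 n ε₂₉ (zeta316OfRecord F 2 n.ν n.τ9.M n.A₁) (RzOfRecord F 2) (ZtOfRecord F 2)) p) →
      BgProvisoΛ F 2 p.K
        (settingOfRecord₁₃ F 2 (theta13LiveOfNumerics F 2 n ε₂₉ (zeta316OfRecord F 2 n.ν n.τ9.M n.A₁) (RzOfRecord F 2) (ZtOfRecord F 2)) p)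
        (RzOfRecord F 2 p.K) n.τ9.M m
        (suppOfRecord₁₃ F 2 (theta13LiveOfNumerics F 2 n ε₂₉ (zeta316OfRecord F 2 n.ν n.τ9.M n.A₁) (RzOfRecord F 2) (ZtOfRecord F 2)) p m)
        (UbgOfRecord₁₃ F 2 (theta13LiveOfNumerics F 2 n ε₂₉ (zeta316OfRecord F 2 n.ν n.τ9.M n.A₁) (RzOfRecord F 2) (ZtOfRecord F 2)) p m))
    (lam13 : B12.RunParams → ResidB13 (theta13LiveOfNumerics F 2 n ε₂₉ (zeta316OfRecord F 2 n.ν n.τ9.M n.A₁) (RzOfRecord F 2) (ZtOfRecord F 2)).toStage3Params)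
    (hleaf : ∀ P, B13LeafOfRecord (theta13LiveOfNumerics F 2 n ε₂₉ (zeta316OfRecord F 2 n.ν n.τ9.M n.A₁) (RzOfRecord F 2) (ZtOfRecord F 2)).toStage3Params (lam13 P)) :
    ∃ (θ : Stage13Params F 2) (h : θ.Provisos₁₃ F 2) (w : WorldP), (θ.ZtUnity F 2 ∧ θ.SlotsNondegenerate₁₃ F 2) ∧ θ.Admissible F 2 ∧
      IsRecordOfRecord₁₃C F 2 (datumOfRecord₁₃ F 2 θ h) w ∧ ∀ P : B12.RunParams, Dag.B13_main (leavesP w P) :=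
  exists_guarded_record₁₃C_b13_main_of_bg_numerics_at F 2 hn hε' hbg lam13 hleaf

end Numerics

/-! ## §2. On the two-letter Stage-13 witness family `θ₁₃(ε₀, ε₂₉) = theta13LiveOfFamily₂ F N ε₀ ε₂₉ (zeta316OfRecord F N (numerics7OfFamily ε₀) 1 1) (RzOfRecord F N) (ZtOfRecord F N)`
(window `½`, κ = 2·10⁴ by `rfl`: the rate row IS K0a's `kp_n10_theta13LiveOfFamily₂`; the witness of record is the member `(ε₀, ε₂₉) = (1, ⅛)`, `theta13LiveOfRecord_eq_family₂`) -/

section Family₂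

variable (F : T4Family) (N : ℕ) [NeZero N] (ε₀ ε₂₉ : ℝ)

/-- **The torus-size binder `hN12` at every member of the two-letter family, for every torus index `m`**: `12 ≤ (θ₁₃(ε₀, ε₂₉).ℓ₆ + 1)·(m + 1)`.
[cite: Balaban1987RG1, (3.54) p.285 and p.251; Balaban1988RG2Cluster, (2.36) p.19 (bookkeeping numeral)] -/
theorem twelve_le_L_mul_theta13LiveOfFamily₂ (m : ℕ) :
    12 ≤ ((theta13LiveOfFamily₂ F N ε₀ ε₂₉ (zeta316OfRecord F N (numerics7OfFamily ε₀) 1 1) (RzOfRecord F N) (ZtOfRecord F N)).ℓ₆ + 1) * (m + 1) := by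
  rw [theta13LiveOfFamily₂_eq_numerics]
  exact twelve_le_L_mul_theta13LiveOfNumerics F N _ _ m

variable {ε₀ ε₂₉}

/-- **N10's CONJUNCT OF `NodesAtSomeRecord13` AT THE MEMBER `θ₁₃(ε₀, ε₂₉)`, FROM THE LEAF** (`0 < ε₀`, `0 < ε₂₉`, `Provisos₁₃` at the member, a per-run [B13] layer with the
leaf): the world bound at the C-binding of the [B13]-pinned Stage-13 view of the member is a ₁₃C record OF THE MEMBER's DATUM, window `½`, block size `F.L`, guard +
admissibility K0a's theorems, `Dag.B13_main` at every run. [cite: Balaban1988RG2Cluster, Lemmas 1–3 pp.9, 11, 20; Balaban1989LargeFieldII, Thm 1 + (0.1) pp.355–356; Balaban1988Convergent, (3.16)–(3.22) pp.268–269; Balaban1987RG1, (1.2) p.260, (2.9) p.266 (bookkeeping)] -/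
theorem exists_record₁₃C_guarded_b13_main_at_theta13LiveOfFamily₂_of_leafOfRecord (hε : 0 < ε₀) (hε' : 0 < ε₂₉)
    (hP : (theta13LiveOfFamily₂ F N ε₀ ε₂₉ (zeta316OfRecord F N (numerics7OfFamily ε₀) 1 1) (RzOfRecord F N) (ZtOfRecord F N)).Provisos₁₃ F N)
    (lam13 : B12.RunParams →
      ResidB13 (theta13LiveOfFamily₂ F N ε₀ ε₂₉ (zeta316OfRecord F N (numerics7OfFamily ε₀) 1 1) (RzOfRecord F N) (ZtOfRecord F N)).toStage3Params)
    (hleaf : ∀ P, B13LeafOfRecord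
      (theta13LiveOfFamily₂ F N ε₀ ε₂₉ (zeta316OfRecord F N (numerics7OfFamily ε₀) 1 1) (RzOfRecord F N) (ZtOfRecord F N)).toStage3Params (lam13 P)) :
    ∃ w : WorldP,
      ((theta13LiveOfFamily₂ F N ε₀ ε₂₉ (zeta316OfRecord F N (numerics7OfFamily ε₀) 1 1) (RzOfRecord F N) (ZtOfRecord F N)).ZtUnity F N ∧
          (theta13LiveOfFamily₂ F N ε₀ ε₂₉ (zeta316OfRecord F N (numerics7OfFamily ε₀) 1 1) (RzOfRecord F N) (ZtOfRecord F N)).SlotsNondegenerate₁₃ F N) ∧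
        (theta13LiveOfFamily₂ F N ε₀ ε₂₉ (zeta316OfRecord F N (numerics7OfFamily ε₀) 1 1) (RzOfRecord F N) (ZtOfRecord F N)).Admissible F N ∧
        IsRecordOfRecord₁₃C F N
          (datumOfRecord₁₃ F N (theta13LiveOfFamily₂ F N ε₀ ε₂₉ (zeta316OfRecord F N (numerics7OfFamily ε₀) 1 1) (RzOfRecord F N) (ZtOfRecord F N)) hP) w ∧
        w.γ = 1 / 2 ∧ w.L = (F.L : ℝ) ∧
        (∀ P, w.up P = upOfRecord₅C F N
          (((theta13LiveOfFamily₂ F N ε₀ ε₂₉ (zeta316OfRecord F N (numerics7OfFamily ε₀) 1 1) (RzOfRecord F N) (ZtOfRecord F N)).pinB13 F N lam13).toStage5₁₃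
            F N) P) ∧
        ∀ P : B12.RunParams, Dag.B13_main (leavesP w P) := by
  have hθ := admissible_theta13LiveOfFamily₂ F N (zeta316OfRecord F N (numerics7OfFamily ε₀) 1 1) (RzOfRecord F N) (ZtOfRecord F N) hε hε'
  obtain ⟨w, hR, hγ, hL, hup, hN⟩ := exists_record₁₃C_pinB13World_b13_main_of_leafOfRecord F N _ hP hθ lam13 (γw := 1 / 2)
    ⟨one_half_pos, (theta13LiveOfFamily₂_γ F N ε₀ ε₂₉ _ _ _).symm.le⟩ hleaf
  exact ⟨w, ⟨ztUnity_theta13LiveOfFamily₂ F N ε₀ ε₂₉, slotsNondegenerate₁₃_theta13LiveOfFamily₂ F N ε₀ ε₂₉ _ _ _ hP⟩, hθ, hR, hγ, hL, hup, hN⟩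

/-- **THE SAME FROM THE FAMILY LEAF OF RECORD** at selected box members with the letters of record (box of height `½` = the member's window).
[cite: Balaban1988RG2Cluster, Lemmas 1–3 pp.9, 11, 20; Balaban1987RG1, Thm 3 p.264; Balaban1989LargeFieldII, Thm 1 + (0.1) pp.355–356] -/
theorem exists_record₁₃C_guarded_b13_main_at_theta13LiveOfFamily₂_of_famLeafOfRecord (hε : 0 < ε₀) (hε' : 0 < ε₂₉)
    (hP : (theta13LiveOfFamily₂ F N ε₀ ε₂₉ (zeta316OfRecord F N (numerics7OfFamily ε₀) 1 1) (RzOfRecord F N) (ZtOfRecord F N)).Provisos₁₃ F N) (c : B13.Consts)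
    (lamF : ResidB13Fam₁₂ F N
      (theta13LiveOfFamily₂ F N ε₀ ε₂₉ (zeta316OfRecord F N (numerics7OfFamily ε₀) 1 1) (RzOfRecord F N) (ZtOfRecord F N)).toStage12Params)
    (hleaf : ∀ P, B13FamLeafOfRecord₁₂ F N
      (theta13LiveOfFamily₂ F N ε₀ ε₂₉ (zeta316OfRecord F N (numerics7OfFamily ε₀) 1 1) (RzOfRecord F N) (ZtOfRecord F N)).toStage12Params c lamF P)
    (κ : B12.RunParams → ℕ) (ν : (P : B12.RunParams) → Fin (κ P + 1) → ℝ) (hν : ∀ P, ν P ∈ FlowStep.Box (1 / 2 : ℝ) (κ P))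
    (hc : ∀ P, (lamF P (κ P) (ν P)).c = c13OfRecord₁₂ F N
      (theta13LiveOfFamily₂ F N ε₀ ε₂₉ (zeta316OfRecord F N (numerics7OfFamily ε₀) 1 1) (RzOfRecord F N) (ZtOfRecord F N)).toStage12Params c) :
    ∃ w : WorldP,
      ((theta13LiveOfFamily₂ F N ε₀ ε₂₉ (zeta316OfRecord F N (numerics7OfFamily ε₀) 1 1) (RzOfRecord F N) (ZtOfRecord F N)).ZtUnity F N ∧
          (theta13LiveOfFamily₂ F N ε₀ ε₂₉ (zeta316OfRecord F N (numerics7OfFamily ε₀) 1 1) (RzOfRecord F N) (ZtOfRecord F N)).SlotsNondegenerate₁₃ F N) ∧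
        (theta13LiveOfFamily₂ F N ε₀ ε₂₉ (zeta316OfRecord F N (numerics7OfFamily ε₀) 1 1) (RzOfRecord F N) (ZtOfRecord F N)).Admissible F N ∧
        IsRecordOfRecord₁₃C F N
          (datumOfRecord₁₃ F N (theta13LiveOfFamily₂ F N ε₀ ε₂₉ (zeta316OfRecord F N (numerics7OfFamily ε₀) 1 1) (RzOfRecord F N) (ZtOfRecord F N)) hP) w ∧
        w.γ = 1 / 2 ∧ w.L = (F.L : ℝ) ∧
        (∀ P, w.up P = upOfRecord₅C F N
          (((theta13LiveOfFamily₂ F N ε₀ ε₂₉ (zeta316OfRecord F N (numerics7OfFamily ε₀) 1 1) (RzOfRecord F N) (ZtOfRecord F N)).pinB13 F N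
            fun P => lamF P (κ P) (ν P)).toStage5₁₃ F N) P) ∧
        ∀ P : B12.RunParams, Dag.B13_main (leavesP w P) :=
  exists_record₁₃C_guarded_b13_main_at_theta13LiveOfFamily₂_of_leafOfRecord F N hε hε' hP (fun P => lamF P (κ P) (ν P))
    fun P => b13LeafOfRecord_member₁₂ (hleaf P) ((theta13LiveOfFamily₂_γ F N ε₀ ε₂₉ _ _ _).symm ▸ hν P) (hc P)

/-- **N10's CONJUNCT OF THE STAGE-13 NODES-∃, WITNESSED AT THE MEMBER `θ₁₃(ε₀, ε₂₉)`, `N = 2`** — from `hP : Provisos₁₃` there (HYPOTHESIS), `0 < ε₀`, `0 < ε₂₉` and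
the leaf; guard and admissibility are K0a's theorems BY NAME.  NOT the stub, NOT a discharge. [cite: Balaban1988RG2Cluster, Lemmas 1–3 pp.9, 11, 20; Balaban1988Convergent, Thm 1 p.262, (3.16)–(3.22) pp.268–269; Balaban1989LargeFieldI, (0.3)–(0.4) p.176 (bookkeeping)] -/
theorem exists_guarded_record₁₃C_b13_main_of_theta13Family₂_provisos_two (F : T4Family) {ε₀ ε₂₉ : ℝ} (hε : 0 < ε₀) (hε' : 0 < ε₂₉)
    (hP : (theta13LiveOfFamily₂ F 2 ε₀ ε₂₉ (zeta316OfRecord F 2 (numerics7OfFamily ε₀) 1 1) (RzOfRecord F 2) (ZtOfRecord F 2)).Provisos₁₃ F 2)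
    (lam13 : B12.RunParams →
      ResidB13 (theta13LiveOfFamily₂ F 2 ε₀ ε₂₉ (zeta316OfRecord F 2 (numerics7OfFamily ε₀) 1 1) (RzOfRecord F 2) (ZtOfRecord F 2)).toStage3Params)
    (hleaf : ∀ P, B13LeafOfRecord
      (theta13LiveOfFamily₂ F 2 ε₀ ε₂₉ (zeta316OfRecord F 2 (numerics7OfFamily ε₀) 1 1) (RzOfRecord F 2) (ZtOfRecord F 2)).toStage3Params (lam13 P)) :
    ∃ (θ : Stage13Params F 2) (h : θ.Provisos₁₃ F 2) (w : WorldP), (θ.ZtUnity F 2 ∧ θ.SlotsNondegenerate₁₃ F 2) ∧ θ.Admissible F 2 ∧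
      IsRecordOfRecord₁₃C F 2 (datumOfRecord₁₃ F 2 θ h) w ∧ ∀ P : B12.RunParams, Dag.B13_main (leavesP w P) := by
  obtain ⟨w, hZ, hθ, hR, -, -, -, hN⟩ := exists_record₁₃C_guarded_b13_main_at_theta13LiveOfFamily₂_of_leafOfRecord F 2 hε hε' hP lam13 hleaf
  exact ⟨_, hP, w, hZ, hθ, hR, hN⟩

/-- **★ N10's CONJUNCT OF THE STAGE-13 NODES-∃ AT `N = 2`, WITNESSED AT THE MEMBER `θ₁₃(ε₀, ε₂₉)`, FROM `0 < ε₀`, `0 < ε₂₉`, ROW P11 AT THE MEMBER (K0a's socket text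
`provisos₁₃_theta13LiveOfFamily₂_of_bg`, ranged token `BgProvisoΛ`) AND THE LEAF.**  A REDUCTION — NOT a discharge. [cite: Balaban1988RG2Cluster, Lemmas 1–3 pp.9, 11, 20; Balaban1988Convergent, (2.7) p.255, (2.28) p.259, (3.16)–(3.22) pp.268–269; Balaban1989LargeFieldI, (0.3)–(0.4) p.176 (bookkeeping)] -/
theorem exists_guarded_record₁₃C_b13_main_of_bg_family₂_two (F : T4Family) {ε₀ ε₂₉ : ℝ} (hε : 0 < ε₀) (hε' : 0 < ε₂₉)
    (hbg : ∀ (p : B12.RunParams) (m : ℕ), m ≤ p.K →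
      Step.InInterval (theta13OfFamily₂ F 2 ε₀ ε₂₉ (zeta316OfRecord F 2 (numerics7OfFamily ε₀) 1 1) (RzOfRecord F 2) (ZtOfRecord F 2)).γ m
        (gOfRecord₁₃ F 2 (theta13OfFamily₂ F 2 ε₀ ε₂₉ (zeta316OfRecord F 2 (numerics7OfFamily ε₀) 1 1) (RzOfRecord F 2) (ZtOfRecord F 2)) p) →
      BgProvisoΛ F 2 p.K
        (settingOfRecord₁₃ F 2 (theta13LiveOfFamily₂ F 2 ε₀ ε₂₉ (zeta316OfRecord F 2 (numerics7OfFamily ε₀) 1 1) (RzOfRecord F 2) (ZtOfRecord F 2)) p)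
        (RzOfRecord F 2 p.K) 1 m
        (suppOfRecord₁₃ F 2 (theta13LiveOfFamily₂ F 2 ε₀ ε₂₉ (zeta316OfRecord F 2 (numerics7OfFamily ε₀) 1 1) (RzOfRecord F 2) (ZtOfRecord F 2)) p m)
        (UbgOfRecord₁₃ F 2 (theta13LiveOfFamily₂ F 2 ε₀ ε₂₉ (zeta316OfRecord F 2 (numerics7OfFamily ε₀) 1 1) (RzOfRecord F 2) (ZtOfRecord F 2)) p m))
    (lam13 : B12.RunParams →
      ResidB13 (theta13LiveOfFamily₂ F 2 ε₀ ε₂₉ (zeta316OfRecord F 2 (numerics7OfFamily ε₀) 1 1) (RzOfRecord F 2) (ZtOfRecord F 2)).toStage3Params)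
    (hleaf : ∀ P, B13LeafOfRecord
      (theta13LiveOfFamily₂ F 2 ε₀ ε₂₉ (zeta316OfRecord F 2 (numerics7OfFamily ε₀) 1 1) (RzOfRecord F 2) (ZtOfRecord F 2)).toStage3Params (lam13 P)) :
    ∃ (θ : Stage13Params F 2) (h : θ.Provisos₁₃ F 2) (w : WorldP), (θ.ZtUnity F 2 ∧ θ.SlotsNondegenerate₁₃ F 2) ∧ θ.Admissible F 2 ∧
      IsRecordOfRecord₁₃C F 2 (datumOfRecord₁₃ F 2 θ h) w ∧ ∀ P : B12.RunParams, Dag.B13_main (leavesP w P) :=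
  exists_guarded_record₁₃C_b13_main_of_theta13Family₂_provisos_two F hε hε' (provisos₁₃_theta13LiveOfFamily₂_of_bg F 2 ε₀ ε₂₉ hbg) lam13 hleaf

end Family₂

/-! ## §3. HONESTY at the members: the ∃-currency is still junk-dischargeable through def-B13's zero tower -/

section Honesty

variable (F : T4Family) (N : ℕ) [NeZero N] {n : Stage12Numerics} {ε₂₉ : ℝ}

/-- **AT EVERY MEMBER OF THE ALL-NUMERICS FAMILY TOO, N10's ∃-conjunct is junk-dischargeable** (`…N10AtRecord13B13.exists_record₁₃C_world_b13_main_of_zeroTower` at the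
member): from `n.Pos`, `0 < ε₂₉` and `Provisos₁₃` at the member ALONE there is a guarded, admissible ₁₃C record of the member's datum with `Dag.B13_main` at every run — so
§1–§2 carry content only when `lam13` is the term tower OF RECORD and the leaf comes from located inputs that are theorems about it.  A reading for the rev-16 planner and
the referees, not against print. [cite: Balaban1988RG2Cluster, (1.33) p.9, (2.9)–(2.14) pp.14–15, Lemmas 1–3 pp.9, 11, 20 (the terms are the expansion's, in print)] -/
theorem exists_guarded_record₁₃C_b13_main_of_theta13Numerics_provisos_of_zeroTower (hn : n.Pos) (hε' : 0 < ε₂₉)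
    (hP : (theta13LiveOfNumerics F N n ε₂₉ (zeta316OfRecord F N n.ν n.τ9.M n.A₁) (RzOfRecord F N) (ZtOfRecord F N)).Provisos₁₃ F N) :
    ∃ (θ : Stage13Params F N) (h : θ.Provisos₁₃ F N) (w : WorldP), (θ.ZtUnity F N ∧ θ.SlotsNondegenerate₁₃ F N) ∧ θ.Admissible F N ∧
      IsRecordOfRecord₁₃C F N (datumOfRecord₁₃ F N θ h) w ∧ w.γ = n.γ ∧ ∀ P : B12.RunParams, Dag.B13_main (leavesP w P) := by
  have hθ := admissible_theta13LiveOfNumerics F N (zeta316OfRecord F N n.ν n.τ9.M n.A₁) (RzOfRecord F N) (ZtOfRecord F N) hn hε'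
  obtain ⟨w, hR, hγ, -, hN⟩ := exists_record₁₃C_world_b13_main_of_zeroTower F N _ hP hθ (γw := n.γ) ⟨hθ.toStage9.gamma_pos, le_rfl⟩
  exact ⟨_, hP, w, ⟨ztUnity_theta13LiveOfNumerics F N n ε₂₉, slotsNondegenerate₁₃_theta13LiveOfNumerics F N n ε₂₉ _ _ _ hP⟩, hθ, hR, hγ, hN⟩

/-- **… and so is the row-P11 form at `N = 2`**: from `n.Pos`, `0 < ε₂₉` and ROW P11 at the member ALONE — NO leaf — the conclusion of §1's
`exists_guarded_record₁₃C_b13_main_of_bg_numerics_two` already holds (zero term tower).  This is WHY that theorem is a reduction of bookkeeping value only until the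
term tower OF RECORD is pinned (ZEROTOWER row; the content clause is the director's to rule). [cite: Balaban1988RG2Cluster, (1.33) p.9, (2.9)–(2.14) pp.14–15 (bookkeeping)] -/
theorem exists_guarded_record₁₃C_b13_main_of_bg_numerics_two_of_zeroTower (F : T4Family) {n : Stage12Numerics} {ε₂₉ : ℝ} (hn : n.Pos) (hε' : 0 < ε₂₉)
    (hbg : ∀ (p : B12.RunParams) (m : ℕ), m ≤ p.K →
      Step.InInterval (theta13OfNumerics F 2 n ε₂₉ (zeta316OfRecord F 2 n.ν n.τ9.M n.A₁) (RzOfRecord F 2) (ZtOfRecord F 2)).γ m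
        (gOfRecord₁₃ F 2 (theta13OfNumerics F 2 n ε₂₉ (zeta316OfRecord F 2 n.ν n.τ9.M n.A₁) (RzOfRecord F 2) (ZtOfRecord F 2)) p) →
      BgProvisoΛ F 2 p.K
        (settingOfRecord₁₃ F 2 (theta13LiveOfNumerics F 2 n ε₂₉ (zeta316OfRecord F 2 n.ν n.τ9.M n.A₁) (RzOfRecord F 2) (ZtOfRecord F 2)) p)
        (RzOfRecord F 2 p.K) n.τ9.M m
        (suppOfRecord₁₃ F 2 (theta13LiveOfNumerics F 2 n ε₂₉ (zeta316OfRecord F 2 n.ν n.τ9.M n.A₁) (RzOfRecord F 2) (ZtOfRecord F 2)) p m)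
        (UbgOfRecord₁₃ F 2 (theta13LiveOfNumerics F 2 n ε₂₉ (zeta316OfRecord F 2 n.ν n.τ9.M n.A₁) (RzOfRecord F 2) (ZtOfRecord F 2)) p m)) :
    ∃ (θ : Stage13Params F 2) (h : θ.Provisos₁₃ F 2) (w : WorldP), (θ.ZtUnity F 2 ∧ θ.SlotsNondegenerate₁₃ F 2) ∧ θ.Admissible F 2 ∧
      IsRecordOfRecord₁₃C F 2 (datumOfRecord₁₃ F 2 θ h) w ∧ ∀ P : B12.RunParams, Dag.B13_main (leavesP w P) := by
  obtain ⟨θ, h, w, hZ, hθ, hR, -, hN⟩ := exists_guarded_record₁₃C_b13_main_of_theta13Numerics_provisos_of_zeroTower F 2 hn hε'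
    (provisos₁₃_theta13LiveOfNumerics_of_bg F 2 n ε₂₉ hbg)
  exact ⟨θ, h, w, hZ, hθ, hR, hN⟩

end Honesty

end Summit.QuantumFields.YangMills.BalabanUVNodes.N10AtRecord13WitnessFamily
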